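import Mathlib
import HarnessLib
import Literature.Probability.Process.RootedHardCoreVague
import Summits.AtomisticToContinuum.Crystallization.Theorems.PalmUnimodularRigidityBenjaminiSchrammLimitCampbell

/-!
# Ergodic reduction for the crux `AperiodicFrustratedLawGap` — Campbell invariance under restriction

Route `FrustratedLawDichotomy`, crux `AperiodicFrustratedLawGap` (item `stmt-AtomisticToContinuum-27623`),
registered stub `stub_ergodicReduction` (skeleton `dd3251ad731e`); companion of
`FrustratedLawDichotomyAperiodicFrustratedLawGapErgodic{Reduction,Pullback,Campbell}` (steps D0/D1/D2/D6 of
the ergodic-decomposition plan recorded in `…ErgodicReduction`).  The configuration-space form of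
"conditioning on an invariant event keeps unimodularity", needed by step D3 (almost-sure Campbell
invariance of the conditional laws given the re-rooting-invariant σ-algebra, tested over invariant events):

* `preimage_reroot_prod_univ` — for a set `B` of rooted hard-core configurations invariant under
  re-rooting (`S ∈ B ↔ S - y ∈ B` for `y ∈ S`), the cylinder `B × ℝ³` is EXACTLY invariant under the
  re-rooting involution `Θ (S, y) = (S - y, -y)` (junk value `(S, -y)` off the incidence set).
* `compProd_restrict_apply` — the Campbell measure of the restricted law: `(Q|_B ⊗ₘ κ₀) C =
  (Q ⊗ₘ κ₀) (C ∩ B × ℝ³)`.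
* `map_reroot_compProd_restrict` — **restriction to an invariant event keeps Campbell invariance**: if
  `(Q ⊗ₘ κ₀).map Θ = Q ⊗ₘ κ₀` and `B` is measurable and re-rooting invariant, then
  `((Q|_B) ⊗ₘ κ₀).map Θ = (Q|_B) ⊗ₘ κ₀`.

`[folklore]` (Aldous–Lyons 2007 §4: conditioning a unimodular measure on an invariant event).
-/

noncomputable section

namespace Summit.AtomisticToContinuum.Crystallization.Theorems.FrustratedLawDichotomyErgodicReduction

open MeasureTheory Set Filter ProbabilityTheory
open scoped ENNReal Classical
open Literature.Probability.Process (LocalConfig)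
open Literature.Probability.Process.LocalConfig (RootedHardCoreConfig toMeasure_def measurable_toMeasure)
open Summit.AtomisticToContinuum.Crystallization.Theorems.BenjaminiSchrammLimit (isSFiniteKernel_toMeasure
  measurable_reroot)

variable {δ : ℝ}

/-- **Invariant cylinders are exactly `Θ`-invariant.**  If `B` is a set of rooted `δ`-hard-core
configurations of `ℝ³` with `S ∈ B ↔ S - y ∈ B` for every point `y ∈ S`, then the preimage of the
cylinder `B × ℝ³` under the re-rooting involution (with its junk value off the incidence set) is
`B × ℝ³`. [folklore] -/
theorem preimage_reroot_prod_univ {B : Set (RootedHardCoreConfig (EuclideanSpace ℝ (Fin 3)) δ)}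
    (hBinv : ∀ (S : RootedHardCoreConfig (EuclideanSpace ℝ (Fin 3)) δ) (y : EuclideanSpace ℝ (Fin 3))
      (hy : y ∈ ((S.1 : LocalConfig (EuclideanSpace ℝ (Fin 3))) : Set (EuclideanSpace ℝ (Fin 3)))),
      S ∈ B ↔ S.reroot y hy ∈ B) :
    (fun p : RootedHardCoreConfig (EuclideanSpace ℝ (Fin 3)) δ × EuclideanSpace ℝ (Fin 3) =>
        ((if h : p.2 ∈ ((p.1.1 : LocalConfig (EuclideanSpace ℝ (Fin 3))) : Set (EuclideanSpace ℝ (Fin 3)))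
          then p.1.reroot p.2 h else p.1 : RootedHardCoreConfig (EuclideanSpace ℝ (Fin 3)) δ), -p.2)) ⁻¹'
      (B ×ˢ (univ : Set (EuclideanSpace ℝ (Fin 3)))) = B ×ˢ (univ : Set (EuclideanSpace ℝ (Fin 3))) := by
  ext ⟨S, y⟩
  simp only [mem_preimage, mem_prod, mem_univ, and_true]
  by_cases hy : y ∈ ((S.1 : LocalConfig (EuclideanSpace ℝ (Fin 3))) : Set (EuclideanSpace ℝ (Fin 3)))
  · rw [dif_pos hy]
    exact (hBinv S y hy).symm
  · rw [dif_neg hy]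

/-- **The Campbell measure of a restricted law** (`δ > 0`): `(Q|_B ⊗ₘ κ₀) C = (Q ⊗ₘ κ₀) (C ∩ B × ℝ³)` for
measurable `B`, `C` (`κ₀ S = count|S`). [folklore] -/
theorem compProd_restrict_apply [Fact (0 < δ)]
    (Q : Measure (RootedHardCoreConfig (EuclideanSpace ℝ (Fin 3)) δ)) [SFinite Q]
    {B : Set (RootedHardCoreConfig (EuclideanSpace ℝ (Fin 3)) δ)} (hB : MeasurableSet B)
    {C : Set (RootedHardCoreConfig (EuclideanSpace ℝ (Fin 3)) δ × EuclideanSpace ℝ (Fin 3))}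
    (hC : MeasurableSet C) :
    haveI := isSFiniteKernel_toMeasure (E := EuclideanSpace ℝ (Fin 3)) (δ := δ)
    ((Q.restrict B) ⊗ₘ (⟨fun S : RootedHardCoreConfig (EuclideanSpace ℝ (Fin 3)) δ =>
        (S.1 : LocalConfig (EuclideanSpace ℝ (Fin 3))).toMeasure,
        measurable_toMeasure (Fact.out : 0 < δ)⟩ :
        Kernel (RootedHardCoreConfig (EuclideanSpace ℝ (Fin 3)) δ) (EuclideanSpace ℝ (Fin 3)))) C =
    (Q ⊗ₘ (⟨fun S : RootedHardCoreConfig (EuclideanSpace ℝ (Fin 3)) δ =>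
        (S.1 : LocalConfig (EuclideanSpace ℝ (Fin 3))).toMeasure,
        measurable_toMeasure (Fact.out : 0 < δ)⟩ :
        Kernel (RootedHardCoreConfig (EuclideanSpace ℝ (Fin 3)) δ) (EuclideanSpace ℝ (Fin 3))))
      (C ∩ B ×ˢ (univ : Set (EuclideanSpace ℝ (Fin 3)))) := by
  haveI := isSFiniteKernel_toMeasure (E := EuclideanSpace ℝ (Fin 3)) (δ := δ)
  rw [Measure.compProd_apply hC, Measure.compProd_apply (hC.inter (hB.prod MeasurableSet.univ)),
    ← lintegral_indicator hB]
  refine lintegral_congr fun S => ?_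
  by_cases hS : S ∈ B
  · rw [indicator_of_mem hS]
    congr 1
    ext y
    simp only [mem_preimage, mem_inter_iff, mem_prod, mem_univ, and_true, hS]
  · rw [indicator_of_notMem hS]
    have h : Prod.mk S ⁻¹' (C ∩ B ×ˢ (univ : Set (EuclideanSpace ℝ (Fin 3)))) = ∅ := by
      ext y
      simp only [mem_preimage, mem_inter_iff, mem_prod, mem_univ, and_true, hS, and_false,
        mem_empty_iff_false]
    rw [h, measure_empty]

/-- **Restriction to an invariant event keeps Campbell invariance** (`δ > 0`).  If the Campbell measure
`Q ⊗ₘ κ₀` of a finite law `Q` on rooted `δ`-hard-core configurations of `ℝ³` is invariant under the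
re-rooting involution `Θ`, and `B` is a measurable set of configurations invariant under re-rooting
(`S ∈ B ↔ S - y ∈ B` for `y ∈ S`), then the Campbell measure of the restricted law `Q|_B` is again
`Θ`-invariant — the configuration-space form of "conditioning a unimodular / point-stationary law on an
invariant event keeps it unimodular". [folklore] -/
theorem map_reroot_compProd_restrict [Fact (0 < δ)]
    {Q : Measure (RootedHardCoreConfig (EuclideanSpace ℝ (Fin 3)) δ)} [SFinite Q]
    (hinv : haveI := isSFiniteKernel_toMeasure (E := EuclideanSpace ℝ (Fin 3)) (δ := δ)
      (Q ⊗ₘ (⟨fun S : RootedHardCoreConfig (EuclideanSpace ℝ (Fin 3)) δ =>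
        (S.1 : LocalConfig (EuclideanSpace ℝ (Fin 3))).toMeasure,
        measurable_toMeasure (Fact.out : 0 < δ)⟩ :
        Kernel (RootedHardCoreConfig (EuclideanSpace ℝ (Fin 3)) δ) (EuclideanSpace ℝ (Fin 3)))).map
      (fun p : RootedHardCoreConfig (EuclideanSpace ℝ (Fin 3)) δ × EuclideanSpace ℝ (Fin 3) =>
        ((if h : p.2 ∈ ((p.1.1 : LocalConfig (EuclideanSpace ℝ (Fin 3))) : Set (EuclideanSpace ℝ (Fin 3)))
          then p.1.reroot p.2 h else p.1 : RootedHardCoreConfig (EuclideanSpace ℝ (Fin 3)) δ), -p.2)) =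
      Q ⊗ₘ (⟨fun S : RootedHardCoreConfig (EuclideanSpace ℝ (Fin 3)) δ =>
        (S.1 : LocalConfig (EuclideanSpace ℝ (Fin 3))).toMeasure,
        measurable_toMeasure (Fact.out : 0 < δ)⟩ :
        Kernel (RootedHardCoreConfig (EuclideanSpace ℝ (Fin 3)) δ) (EuclideanSpace ℝ (Fin 3))))
    {B : Set (RootedHardCoreConfig (EuclideanSpace ℝ (Fin 3)) δ)} (hB : MeasurableSet B)
    (hBinv : ∀ (S : RootedHardCoreConfig (EuclideanSpace ℝ (Fin 3)) δ) (y : EuclideanSpace ℝ (Fin 3))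
      (hy : y ∈ ((S.1 : LocalConfig (EuclideanSpace ℝ (Fin 3))) : Set (EuclideanSpace ℝ (Fin 3)))),
      S ∈ B ↔ S.reroot y hy ∈ B) :
    haveI := isSFiniteKernel_toMeasure (E := EuclideanSpace ℝ (Fin 3)) (δ := δ)
    ((Q.restrict B) ⊗ₘ (⟨fun S : RootedHardCoreConfig (EuclideanSpace ℝ (Fin 3)) δ =>
        (S.1 : LocalConfig (EuclideanSpace ℝ (Fin 3))).toMeasure,
        measurable_toMeasure (Fact.out : 0 < δ)⟩ :
        Kernel (RootedHardCoreConfig (EuclideanSpace ℝ (Fin 3)) δ) (EuclideanSpace ℝ (Fin 3)))).map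
      (fun p : RootedHardCoreConfig (EuclideanSpace ℝ (Fin 3)) δ × EuclideanSpace ℝ (Fin 3) =>
        ((if h : p.2 ∈ ((p.1.1 : LocalConfig (EuclideanSpace ℝ (Fin 3))) : Set (EuclideanSpace ℝ (Fin 3)))
          then p.1.reroot p.2 h else p.1 : RootedHardCoreConfig (EuclideanSpace ℝ (Fin 3)) δ), -p.2)) =
    (Q.restrict B) ⊗ₘ (⟨fun S : RootedHardCoreConfig (EuclideanSpace ℝ (Fin 3)) δ =>
        (S.1 : LocalConfig (EuclideanSpace ℝ (Fin 3))).toMeasure,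
        measurable_toMeasure (Fact.out : 0 < δ)⟩ :
        Kernel (RootedHardCoreConfig (EuclideanSpace ℝ (Fin 3)) δ) (EuclideanSpace ℝ (Fin 3))) := by
  haveI := isSFiniteKernel_toMeasure (E := EuclideanSpace ℝ (Fin 3)) (δ := δ)
  have hδ : 0 < δ := Fact.out
  have hΘ : Measurable (fun p : RootedHardCoreConfig (EuclideanSpace ℝ (Fin 3)) δ × EuclideanSpace ℝ (Fin 3) =>
      ((if h : p.2 ∈ ((p.1.1 : LocalConfig (EuclideanSpace ℝ (Fin 3))) : Set (EuclideanSpace ℝ (Fin 3)))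
        then p.1.reroot p.2 h else p.1 : RootedHardCoreConfig (EuclideanSpace ℝ (Fin 3)) δ), -p.2)) :=
    measurable_reroot hδ
  refine Measure.ext fun C hC => ?_
  have hset : (fun p : RootedHardCoreConfig (EuclideanSpace ℝ (Fin 3)) δ × EuclideanSpace ℝ (Fin 3) =>
        ((if h : p.2 ∈ ((p.1.1 : LocalConfig (EuclideanSpace ℝ (Fin 3))) : Set (EuclideanSpace ℝ (Fin 3)))
          then p.1.reroot p.2 h else p.1 : RootedHardCoreConfig (EuclideanSpace ℝ (Fin 3)) δ), -p.2)) ⁻¹' C ∩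
        B ×ˢ (univ : Set (EuclideanSpace ℝ (Fin 3))) =
      (fun p : RootedHardCoreConfig (EuclideanSpace ℝ (Fin 3)) δ × EuclideanSpace ℝ (Fin 3) =>
        ((if h : p.2 ∈ ((p.1.1 : LocalConfig (EuclideanSpace ℝ (Fin 3))) : Set (EuclideanSpace ℝ (Fin 3)))
          then p.1.reroot p.2 h else p.1 : RootedHardCoreConfig (EuclideanSpace ℝ (Fin 3)) δ), -p.2)) ⁻¹'
        (C ∩ B ×ˢ (univ : Set (EuclideanSpace ℝ (Fin 3)))) := by
    rw [preimage_inter, preimage_reroot_prod_univ hBinv]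
  rw [Measure.map_apply hΘ hC, compProd_restrict_apply Q hB (hΘ hC), compProd_restrict_apply Q hB hC,
    hset, ← Measure.map_apply hΘ (hC.inter (hB.prod MeasurableSet.univ)), hinv]

end Summit.AtomisticToContinuum.Crystallization.Theorems.FrustratedLawDichotomyErgodicReduction

end
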